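import Summits.QuantumFields.YangMills.Theorems.BalabanUVNodesN16H7OfReg9
import HarnessLib

/-!
# Route «BalabanUVNodes» (K3⁷ `SpineGivenEndpointR13SepCoPH`, stmt-QuantumFields-20544), DAG node N16 = NE3 — THE N07 → N16 EDGE `h7` DECOMPOSED:
# `stub_h7` ⇐ [B11] THEOREM 1 AT THE TORUS INSTANCES (loose data) ∧ THE TIGHT-WINDOW LEAF (the located non-print residue, ONE displayed hypothesis);
# far data are VACUOUS by [B7] Proposition 2 (proved in the tree, k-uniformly)

Cell `pub-ymgap`, width seat `pub-ymgap-dag-n16-w1` (director-ym №197 ∕ HUMAN RULING D-0149; plan g77 `W-SEAT-START-LIST.md` §2 n16 item 1 = (W1) THE N07-EDGE),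
generation 0, file 2 — over file 1 `BalabanUVNodesN16H7OfReg9` (p584527) and its LOCATED note (evidence #9 on stmt-QuantumFields-20544,
`HOME/pub-ymgap-dag-n16-w1/LOCATED-N16-H7-PRINT-GAP.md`).  `--kind proof --supports stmt-QuantumFields-20544 --as helper` (count-neutral).  `bears_on: R4∕N16 · edge N07 → N16`.

THE POINT.  File 1 §3 derived N16's sup-form Thm-1-TYPE leaf `LeafH3sup d L N ε (Cε) (Cε) ·` ON LOOSE DATA `V ∈ sfClass d L N (ε∕B₃) 0` from [Balaban1985Variational]
Theorem 1 read at leaf-06's torus instances (`B11Thm1.Thm1At C (MinimalActionDictionary.torusVP d L N G (k+1))`), and located the residue of `stub_h7` (ALL data) as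
the item AP-N16-2 «tight data».  [Balaban1985Averaging] Proposition 2 (52)–(54) p. 26 is PROVED in the tree for the concrete iterated average (42)∕(43), UNIFORMLY in
the number of levels (`B7Prop2Explicit.prop2_unitaryUnits` ∕ `prop2_explicit_lt_two`: `sup_p|U(∂p) − 1| < α₀η²` ⟹ `sup_p|Ū^k(∂p) − 1| < 2α₀`).  Hence a datum `V` with
SOME plaquette at distance `> 4ε` from `1` admits NO configuration of `sfClass d L N ε (k+1)` with `avgIter L · (k+1) = V` at ANY level — the leaf is VACUOUS there —
and the non-print content of `stub_h7` is EXACTLY the leaf on the TIGHT WINDOW «`V ∉ sfClass d L N (ε∕B₃) 0` and `SmallField V (4ε)`» (data whose (7)-size is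
comparable to the class radius: constrained minimisers in a ball smaller than print's (8), about which Theorem 1 p. 279 says nothing).

WHAT THIS FILE PROVES (kernel, theorems only, 0 `def`, 0 sorry; BY NAME over landed modules).
* §1 `pdev_le_of_mem_sfClass` (class membership ⟹ `pdev U ≤ ε∕(L^{k+1})²`, `Real.iSup_le`), **`smallField_datum_of_isMinimiser`** — if a minimiser of run `k+1` over
  `sfClass d L N ε` with datum `V` EXISTS (indeed: if the admissible set is non-empty), then `SmallField V (4ε)`, for `L ≥ 2`, `0 < ε`, `C₀(d)·2ε ≤ ⅓`, `4ε ≤ c₂′(d,L)` —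
  [Balaban1985Averaging] Prop. 2 (54) BY NAME at `α₀ = 2ε` (`B7Prop2Explicit.prop2_explicit_lt_two`, unitarity of the averages `prop2_unitaryUnits`, `le_pdev`).
* §2 **`leafH3sup_of_loose_of_tight`** — for any splitting radius `δ`: the leaf on `dom ∩ sfClass d L N δ 0` (LOOSE) and on `dom ∩ {V ∉ sfClass d L N δ 0, SmallField V (4ε)}`
  (TIGHT WINDOW) give the leaf on `dom` (FAR data vacuous by §1); `leafH3sup_iff_loose_and_tight` (with the converse projections `leafH3sup_anti`: the decomposition is exact).
* §3 **`h7Shape_of_thm1At_torusVP_of_tightLeaf`** — ★ `∀ k, B11Thm1.Thm1At C (torusVP d L N G (k+1))` (Theorem 1 for the torus instances, displayed hypothesis; interface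
  binders `hGm`∕`hG` on the local-gauge shape `G` and `M(e) ≥ 7∕2` as in file 1) ∧ THE TIGHT-WINDOW LEAF FAMILY HYPOTHESIS
  `∃ Ct a, 0 ≤ Ct ∧ 0 < a ∧ ∀ ε ∈ ]0,a], LeafH3sup d L N ε (Ct·ε) (Ct·ε) {V ∈ dom | V ∉ sfClass d L N (ε∕B₃) 0 ∧ SmallField V (4ε)}` (= AP-N16-2 as a Lean statement; NOT in
  print; asserted for nothing) ⟹ the SHAPE of `stub_h7` on ALL of `dom`: `∃ C ε₀, 0 ≤ C ∧ 0 < ε₀ ∧ ∀ ε ∈ ]0,ε₀], LeafH3sup d L N ε (Cε) (Cε) dom`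
  (`C = max 16937 Ct`, `ε₀ = min(B₃a₁, 1∕28, a, 1∕(6C₀), c₂′∕4)`); **`h7_at_record_of_thm1At_of_tightLeaf`** — d = 4, `L = F.L`, `Nper = ne3NperOfRecord₁₁ F 0 0`,
  `dom = ne3DomOfRecord₁₁ F N 0 0`: LITERALLY `stub_h7`'s statement (dag-n16-e's evidence #6) from Theorem 1 at the record's torus instances ∧ AP-N16-2-at-record.

WHAT REMAINS DISPLAYED (honest): (i) `Thm1At` = [Balaban1985Variational] Thm 1 for the torus instances (leaf-06's divergences D-s3-1…6; D-s3-1 = the plaquette-only class,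
i.e. the located item AP-N16-1 absorbed in the instance's reading of (8)); (ii) the tight-window leaf (AP-N16-2).  Everything else ([B7] Prop. 2, the (9) ⟹ `RegularSup`
dictionary, the level and constant bookkeeping) is kernel-checked.

HONEST FRAMING.  Bookkeeping over landed theorems BY NAME; nothing of Bałaban asserted hypothesis-free except what the tree PROVES ([B7] Prop. 2 for (42)∕(43));
`stub_h7` NOT closed; N16 ∕ NE3 NOT discharged; count-neutral; counts of record unmoved (typed 28∕28 · discharged 5∕27); one finite four-torus at fixed `ε`, Bałaban AS
PRINTED — NOT ℝ⁴, NOT infinite volume, NOT OS, NOT a mass gap; the YM mass gap (Clay) is NOT proved by any of this — R4 closes the conditional finite-𝕋⁴ rung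
`BalabanLadder.UV` only.
-/

set_option autoImplicit false

open scoped BigOperators Matrix Matrix.Norms.L2Operator
open NormedSpace

namespace Summit.QuantumFields.YangMills.BalabanUVNodes.N16H7TightWindow

open Literature.MathematicalPhysics.QuantumFieldTheory.Balaban1983to89
open B7Prop1Explicit B7Prop2Explicit MatrixLog UnitaryModel
open T4AveragingDeficitWall hiding Site Plane Plaq Bond
open T4AveragingDeficitWallBoundary (IsPeriodicCfg)
open T4Continuum (T4Family)
open Summit.QuantumFields.BalabanUV.T4Continuum
open AveragingDeficitLatticeH2Prep (fd)
open MinimalActionSandwich (IsMinimiser)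
open MinimalActionRate (sfClass)
open MinimalActionRefine (RegularSup)
open MinimalActionDictionary (torusVP RadiiMono)
open NE3.LeafIndexSockets (LeafH3sup)
open B11Thm1 (Thm1At)
open Node00 (ne3NperOfRecord₁₁ ne3DomOfRecord₁₁ MatA)
open Summit.QuantumFields.YangMills.BalabanUVNodes.N16H7OfReg9 (leafH3sup_mono leafH3sup_anti leafH3sup_loose_of_thm1At_torusVP)

noncomputable section

variable {d : ℕ} {n : Type} [Fintype n] [DecidableEq n]

/-! ## §1 [B7] Proposition 2 BY NAME: a minimiser's datum is `4ε`-small (far data are vacuous) -/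

/-- Class membership bounds the plaquette supremum: `U ∈ sfClass d L N ε j` ⟹ `pdev U ≤ ε∕(L^j)²` (`Real.iSup_le`; the diagonal words `plaqWord κ κ` have
holonomy `1`, `B7Prop2Explicit.hol_plaqWord_self`). [folklore] -/
theorem pdev_le_of_mem_sfClass {L N j : ℕ} {ε : ℝ} (hε : 0 ≤ ε) {U : Site d → Fin d → (Matrix n n ℂ)ˣ} (hU : U ∈ sfClass d L N ε j) :
    pdev U ≤ ε / ((L : ℝ) ^ j) ^ 2 := by
  obtain ⟨-, -, hs⟩ := hU
  have h0 : 0 ≤ ε / ((L : ℝ) ^ j) ^ 2 := by positivity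
  unfold pdev
  refine Real.iSup_le (fun p => ?_) h0
  rcases eq_or_ne p.2.1 p.2.2 with h | h
  · rw [h, hol_plaqWord_self]
    simpa using h0
  · exact hs p.1 p.2.1 p.2.2 h

/-- **A MINIMISER'S DATUM IS `4ε`-SMALL** ([Balaban1985Averaging] Prop. 2 (54) BY NAME, uniformly in the level).  Let `L ≥ 2`, `0 < ε`, `C₀(d)·(2ε) ≤ ⅓`,
`2·(2ε) ≤ c₂′(d,L)`.  If `U` minimises run `k+1` over `sfClass d L N ε` with datum `V` — in particular `U ∈ sfClass d L N ε (k+1)` and `avgIter L U (k+1) = V` — then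
every unit plaquette of `V` is within `4ε` of the identity: `pdev U ≤ εη² < 2εη²` (`η = L^{−(k+1)}`), Prop. 2 at `α₀ = 2ε` gives `pdev (avgIter L U (k+1)) < 4ε`
(`B7Prop2Explicit.prop2_explicit_lt_two`, averages unitary by `prop2_unitaryUnits`), and `le_pdev`.  So data with a plaquette farther than `4ε` from `1` carry NO
minimiser at any level: the leaf (H3ˢᵘᵖ) is vacuous there. [cite: Balaban1985Averaging, Prop. 2 (52)–(54) p.26] -/
theorem smallField_datum_of_isMinimiser [Nonempty n] {L N : ℕ} (hL : 2 ≤ L) {ε : ℝ} (hε : 0 < ε) (hε3 : C0 d * (2 * ε) ≤ 1 / 3)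
    (hε2 : 2 * (2 * ε) ≤ c2' d L) {k : ℕ} {V U : Site d → Fin d → (Matrix n n ℂ)ˣ} (hU : IsMinimiser d (sfClass d L N ε) L N (k + 1) V U) :
    SmallField V (4 * ε) := by
  letI : CStarAlgebra (Matrix n n ℂ) := {}
  have hmem : U ∈ sfClass d L N ε (k + 1) := hU.mem.1
  have havg : avgIter L U (k + 1) = V := hU.mem.2
  obtain ⟨hu, -, -⟩ := hU.mem.1
  have hLk : (0 : ℝ) < ((L : ℝ) ^ (k + 1)) ^ 2 := by
    have hL0 : (0 : ℝ) < L := by exact_mod_cast (by omega : 0 < L)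
    positivity
  have hpdev : pdev U < 2 * ε * (((L : ℝ) ^ (k + 1))⁻¹) ^ 2 := by
    have hle := pdev_le_of_mem_sfClass hε.le hmem
    rw [inv_pow, ← div_eq_mul_inv]
    exact hle.trans_lt (div_lt_div_of_pos_right (by linarith) hLk)
  have hα : (0 : ℝ) < 2 * ε := by linarith
  have h54 := prop2_explicit_lt_two L hL (avgClosed_unitaryUnits d L) (k + 1) U hu hα hε3 hε2 hpdev
  have hunit := (prop2_unitaryUnits L hL (k + 1) U hu hα hε3 hε2 hpdev).2 (k + 1) le_rfl
  rw [havg] at h54 hunit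
  have hV1 : ∀ x κ, V x κ ∈ U1 (Matrix n n ℂ) := fun x κ => unitaryUnits_le_U1 (hunit x κ)
  intro x κ κ' _
  have h := le_pdev hV1 x κ κ'
  linarith

/-! ## §2 The decomposition of the leaf: loose ∪ tight window (far data vacuous) -/

/-- **THE LEAF (H3ˢᵘᵖ) FROM ITS LOOSE AND TIGHT-WINDOW PARTS.**  For any splitting radius `δ` (print: `δ = ε∕B₃`), the leaf on the LOOSE data `dom ∩ sfClass d L N δ 0`
and on the TIGHT WINDOW `dom ∩ {V ∉ sfClass d L N δ 0, SmallField V (4ε)}` give the leaf on all of `dom` — the remaining (FAR) data carry no minimiser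
(`smallField_datum_of_isMinimiser`). [folklore] -/
theorem leafH3sup_of_loose_of_tight [Nonempty n] {L N : ℕ} (hL : 2 ≤ L) {ε δ b c : ℝ} (hε : 0 < ε) (hε3 : C0 d * (2 * ε) ≤ 1 / 3)
    (hε2 : 2 * (2 * ε) ≤ c2' d L) {dom : Set (Site d → Fin d → (Matrix n n ℂ)ˣ)}
    (hloose : LeafH3sup d L N ε b c {V | V ∈ dom ∧ V ∈ sfClass d L N δ 0})
    (htight : LeafH3sup d L N ε b c {V | V ∈ dom ∧ V ∉ sfClass d L N δ 0 ∧ SmallField V (4 * ε)}) :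
    LeafH3sup d L N ε b c dom := by
  intro V hV k U hU
  by_cases hVl : V ∈ sfClass d L N δ 0
  · exact hloose V ⟨hV, hVl⟩ k U hU
  · exact htight V ⟨hV, hVl, smallField_datum_of_isMinimiser hL hε hε3 hε2 hU⟩ k U hU

/-- The decomposition is EXACT: the leaf on `dom` is equivalent to the conjunction of its loose and tight-window parts (converse by `leafH3sup_anti`). [folklore] -/
theorem leafH3sup_iff_loose_and_tight [Nonempty n] {L N : ℕ} (hL : 2 ≤ L) {ε δ b c : ℝ} (hε : 0 < ε) (hε3 : C0 d * (2 * ε) ≤ 1 / 3)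
    (hε2 : 2 * (2 * ε) ≤ c2' d L) {dom : Set (Site d → Fin d → (Matrix n n ℂ)ˣ)} :
    LeafH3sup d L N ε b c dom ↔
      LeafH3sup d L N ε b c {V | V ∈ dom ∧ V ∈ sfClass d L N δ 0} ∧
        LeafH3sup d L N ε b c {V | V ∈ dom ∧ V ∉ sfClass d L N δ 0 ∧ SmallField V (4 * ε)} :=
  ⟨fun h => ⟨leafH3sup_anti h fun _ hV => hV.1, leafH3sup_anti h fun _ hV => hV.1⟩,
    fun h => leafH3sup_of_loose_of_tight hL hε hε3 hε2 h.1 h.2⟩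

/-! ## §3 `stub_h7`'s shape ⇐ Theorem 1 at the torus instances ∧ the tight-window leaf -/

/-- **★ THE SHAPE OF `stub_h7` ON ALL DATA FROM [B11] THEOREM 1 AT THE TORUS INSTANCES AND THE TIGHT-WINDOW LEAF.**  Let `L ≥ 2`; `G` a local-gauge shape with the
interface binders of file 1 (`hGm` monotone in the radii, `hG` at least as fine as (9)_{β₀=1} sup data about the cube's centre); `C : B11Thm1.Consts` with `M(e) ≥ 7∕2`
on `]0,a₁]`; `hT : ∀ k, Thm1At C (torusVP d L N G (k+1))` ([Balaban1985Variational] Thm 1 for the torus instances — DISPLAYED hypothesis); and THE TIGHT-WINDOW LEAF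
FAMILY `htight : ∃ Ct a, 0 ≤ Ct ∧ 0 < a ∧ ∀ ε ∈ ]0,a], LeafH3sup d L N ε (Ct·ε) (Ct·ε) {V ∈ dom | V ∉ sfClass d L N (ε∕B₃) 0 ∧ SmallField V (4ε)}` (the located
item AP-N16-2 — NOT in print; DISPLAYED hypothesis).  THEN `∃ C ε₀, 0 ≤ C ∧ 0 < ε₀ ∧ ∀ ε ∈ ]0,ε₀], LeafH3sup d L N ε (Cε) (Cε) dom` — loose part by file 1 §3
(`leafH3sup_loose_of_thm1At_torusVP`), far part vacuous (§1), tight part the hypothesis; `C = max 16937 Ct`, `ε₀ = min(min(B₃a₁, 1∕28), min(a, min(1∕(6C₀(d)), c₂′(d,L)∕4)))`.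
[cite: Balaban1985Variational, Thm 1 (8)–(10) p.279] -/
theorem h7Shape_of_thm1At_torusVP_of_tightLeaf [Nonempty n] {L N : ℕ} (hL : 2 ≤ L)
    {G : (Site d → Fin d → (Matrix n n ℂ)ˣ) → Site d → ℕ → ℝ → ℝ → ℝ → Prop} (hGm : RadiiMono d G)
    (hG : ∀ (U : Site d → Fin d → (Matrix n n ℂ)ˣ) (x : Site d) (K : ℕ) (α₀ α₁ α₂ : ℝ), 2 ≤ K → G U x K α₀ α₁ α₂ →
      ∃ (u : Site d → (Matrix n n ℂ)ˣ) (a : Site d → Fin d → Matrix n n ℂ),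
        (∀ z, u z ∈ unitaryUnits (Matrix n n ℂ)) ∧
        (∀ (y : Site d) (τ : Fin d), l1 (y - x) ≤ 2 → ((gaugeAct u U y τ : (Matrix n n ℂ)ˣ) : Matrix n n ℂ) = exp (a y τ)) ∧
        (∀ (y : Site d) (τ : Fin d), l1 (y - x) ≤ 2 → ‖a y τ‖ ≤ α₀) ∧
        (∀ (y : Site d) (τ i : Fin d), l1 (y - x) ≤ 1 → ‖fd i (fun z => a z τ) y‖ ≤ α₁) ∧
        (∀ (τ i l : Fin d), ‖fd i (fd l (fun z => a z τ)) x‖ ≤ α₂))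
    (C : B11Thm1.Consts) (hM : ∀ e : ℝ, 0 < e → e ≤ C.a₁ → 7 / 2 ≤ C.Mfun e)
    (hT : ∀ k : ℕ, Thm1At C (torusVP d L N G (k + 1)))
    {dom : Set (Site d → Fin d → (Matrix n n ℂ)ˣ)}
    (htight : ∃ Ct a : ℝ, 0 ≤ Ct ∧ 0 < a ∧ ∀ ε : ℝ, 0 < ε → ε ≤ a →
      LeafH3sup d L N ε (Ct * ε) (Ct * ε) {V | V ∈ dom ∧ V ∉ sfClass d L N (ε / C.B₃) 0 ∧ SmallField V (4 * ε)}) :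
    ∃ C' ε₀ : ℝ, 0 ≤ C' ∧ 0 < ε₀ ∧ ∀ ε : ℝ, 0 < ε → ε ≤ ε₀ → LeafH3sup d L N ε (C' * ε) (C' * ε) dom := by
  obtain ⟨Ct, a, hCt, ha, htight⟩ := htight
  have hL1 : 1 ≤ L := by omega
  have hC0 := C0_pos d
  have hc2 := c2'_pos d L hL1
  refine ⟨max 16937 Ct, min (min (C.B₃ * C.a₁) (1 / 28)) (min a (min (1 / (6 * C0 d)) (c2' d L / 4))), le_trans (by norm_num) (le_max_left _ _),
    lt_min (lt_min (mul_pos C.B₃_pos C.a₁_pos) (by norm_num)) (lt_min ha (lt_min (by positivity) (by positivity))), fun ε hε hεle => ?_⟩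
  have h1 : ε ≤ C.B₃ * C.a₁ := hεle.trans ((min_le_left _ _).trans (min_le_left _ _))
  have h2 : ε ≤ 1 / 28 := hεle.trans ((min_le_left _ _).trans (min_le_right _ _))
  have h3 : ε ≤ a := hεle.trans ((min_le_right _ _).trans (min_le_left _ _))
  have h4 : ε ≤ 1 / (6 * C0 d) := hεle.trans ((min_le_right _ _).trans ((min_le_right _ _).trans (min_le_left _ _)))
  have h5 : ε ≤ c2' d L / 4 := hεle.trans ((min_le_right _ _).trans ((min_le_right _ _).trans (min_le_right _ _)))
  have hε3 : C0 d * (2 * ε) ≤ 1 / 3 := by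
    have : ε * (6 * C0 d) ≤ 1 := by rwa [le_div_iff₀ (by positivity)] at h4
    nlinarith
  have hε2 : 2 * (2 * ε) ≤ c2' d L := by linarith
  have hloose := leafH3sup_loose_of_thm1At_torusVP hL1 hGm hG C hM hT hε h1 h2 dom
  refine leafH3sup_of_loose_of_tight hL hε hε3 hε2 (δ := ε / C.B₃) (leafH3sup_mono hloose ?_ ?_) (leafH3sup_mono (htight ε hε h3) ?_ ?_)
  · exact le_mul_of_one_le_left hε.le (le_trans (by norm_num) (le_max_left _ _))
  · exact mul_le_mul_of_nonneg_right (le_max_left _ _) hε.le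
  · exact mul_le_mul_of_nonneg_right (le_max_right _ _) hε.le
  · exact mul_le_mul_of_nonneg_right (le_max_right _ _) hε.le

/-- **`stub_h7`'S STATEMENT, LITERALLY, FROM [B11] THEOREM 1 AT THE RECORD'S TORUS INSTANCES ∧ THE TIGHT-WINDOW LEAF AT THE RECORD** (d = 4, `L = F.L`, period
`ne3NperOfRecord₁₁ F 0 0`, data `ne3DomOfRecord₁₁ F N 0 0`; dag-n16-e's evidence #6 `N16DischargeTest.stub_h7`).  The two displayed hypotheses are exactly the two located
items of evidence #9: Theorem 1 for leaf-06's instances (plaquette-only class, D-s3-1 = AP-N16-1) and AP-N16-2 (tight window).  Nothing of Bałaban is asserted.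
[cite: Balaban1985Variational, Thm 1 (8)–(10) p.279] -/
theorem h7_at_record_of_thm1At_of_tightLeaf {N : ℕ} [NeZero N] (F : T4Family)
    {G : (Site 4 → Fin 4 → (MatA N)ˣ) → Site 4 → ℕ → ℝ → ℝ → ℝ → Prop} (hGm : RadiiMono 4 G)
    (hG : ∀ (U : Site 4 → Fin 4 → (MatA N)ˣ) (x : Site 4) (K : ℕ) (α₀ α₁ α₂ : ℝ), 2 ≤ K → G U x K α₀ α₁ α₂ →
      ∃ (u : Site 4 → (MatA N)ˣ) (a : Site 4 → Fin 4 → MatA N),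
        (∀ z, u z ∈ unitaryUnits (MatA N)) ∧
        (∀ (y : Site 4) (τ : Fin 4), l1 (y - x) ≤ 2 → ((gaugeAct u U y τ : (MatA N)ˣ) : MatA N) = exp (a y τ)) ∧
        (∀ (y : Site 4) (τ : Fin 4), l1 (y - x) ≤ 2 → ‖a y τ‖ ≤ α₀) ∧
        (∀ (y : Site 4) (τ i : Fin 4), l1 (y - x) ≤ 1 → ‖fd i (fun z => a z τ) y‖ ≤ α₁) ∧
        (∀ (τ i l : Fin 4), ‖fd i (fd l (fun z => a z τ)) x‖ ≤ α₂))
    (C : B11Thm1.Consts) (hM : ∀ e : ℝ, 0 < e → e ≤ C.a₁ → 7 / 2 ≤ C.Mfun e)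
    (hT : ∀ k : ℕ, Thm1At C (torusVP 4 F.L (ne3NperOfRecord₁₁ F 0 0) G (k + 1)))
    (htight : ∃ Ct a : ℝ, 0 ≤ Ct ∧ 0 < a ∧ ∀ ε : ℝ, 0 < ε → ε ≤ a →
      LeafH3sup 4 F.L (ne3NperOfRecord₁₁ F 0 0) ε (Ct * ε) (Ct * ε)
        {V | V ∈ ne3DomOfRecord₁₁ F N 0 0 ∧ V ∉ sfClass 4 F.L (ne3NperOfRecord₁₁ F 0 0) (ε / C.B₃) 0 ∧ SmallField V (4 * ε)}) :
    ∃ C' ε₀ : ℝ, 0 ≤ C' ∧ 0 < ε₀ ∧ ∀ ε : ℝ, 0 < ε → ε ≤ ε₀ →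
      LeafH3sup 4 F.L (ne3NperOfRecord₁₁ F 0 0) ε (C' * ε) (C' * ε) (ne3DomOfRecord₁₁ F N 0 0) :=
  h7Shape_of_thm1At_torusVP_of_tightLeaf F.hL.2 hGm hG C hM hT htight

end

end Summit.QuantumFields.YangMills.BalabanUVNodes.N16H7TightWindow
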